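import Summits.ResolutionOfSingularities.ResolutionOfSingularities.Theorems.HilbertSamuelEliminationSigmaMaxModificationsCorridor3Directrix214SharpCentre
import Summits.ResolutionOfSingularities.ResolutionOfSingularities.Theorems.HilbertSamuelEliminationCampaignW42ProjDirectrixOfDirDimEq
import Literature.RingTheory.MvPolynomial.DirectrixPolynomialExtension
import HarnessLib

/-!
# [OURS · L1 W4.2] The direction of a near point of a permissible blow-up is a point of Giraud's RIDGE of the fibre
# `C_{X,D,x}` of the normal cone, in Hironaka's chart data `(t, u)`; `e(J · k[X,Y]) = e(J) + s`; `fibreConeIdeal = normalConeIdeal`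
# (campaign s42, cell res-hironaka; informal crux `RidgeConfinement`, stmt-ResolutionOfSingularities-17845; `--supports`;
# tools for `…CampaignW42Theorem314NumericalOfDirDimEq`)

HONEST FRAMING. OURS (slot W4.2, prover res-L1-s42-pv-1, gen 4). Three tools:

* `finrank_directrixSpace_map_rename_castAdd` / `directrixDim_map_rename_castAdd` — CJS Rem. 2.9 (c) for `s` variables:
  `e(J · k[X, Y_1..Y_s]) = e(J) + s` (the tree had `s = 1`, `directrixDim_map_rename_castSucc`, and the inequality `≥`,
  res-type-001's `directrixDim_add_le_directrixDim_map_rename`); `≤` by transport along the retraction `Y ↦ 0`;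
* `fibreConeIdeal_eq_normalConeIdeal` — this campaign's ideal of the fibre cone (`CampaignW42.fibreConeIdeal`, p506435) IS
  res-type-001's `normalConeIdeal` (`NormalConeFibreIdeal.lean`): a form `F̄` of degree `d` lies in either iff `F(g) ∈ 𝔪·I^d`;
* **`residue_mem_ridge_normalConeIdeal_of_isNearPoint`** — THE DIRECTION OF A NEAR POINT LIES IN THE RIDGE OF THE FIBRE CONE,
  scheme level, for ANY generators `g` of `I_{D,x}` and ANY chart datum `(t, u)` at `x'` (`t` a non-zero-divisor,
  `I_{D,x}𝒪_{X',x'} = (t)`, `π♯(g_i) = u_i t` — Hironaka 1970 (13.1), the data of F-51′ `Hironaka1970_thmIV`):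
  `ū ∈ F(J_D)(κ(x'))` for the `κ(x)`-algebra structure of `κ(x')` through `π` (gen-3's `aeval_chartGen_mem_ridge_of_isNearRing`,
  p508958, through a Rees chart at `x'`, rescaled by the unit `t/π♯(g_{j₀})`). Hypotheses: `D` permissible at `x`, `𝒪_{X,x}`
  universally catenary, `x'` near at level `N` — every characteristic, every residue field, no named fact.

NOTHING here is a statement of H. Hironaka's manuscript [Hironaka2017]. AI review is weaker than expert review. References
(orientation only): V. Cossart, U. Jannsen, S. Saito, LNM 2270 (2020), Rem. 2.9 (c), Thm. 3.14, Rem. 18.29 (1); H. Hironaka,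
J. Math. Kyoto Univ. 10 (1970), §2, (13.1); J. Giraud (1975), Cor. 2.4.
-/

noncomputable section

-- single-conjunct summit: the doubled namespace component `ResolutionOfSingularities` is mandated
set_option linter.dupNamespace false

open CategoryTheory AlgebraicGeometry TopologicalSpace IsLocalRing MvPolynomial
open Literature.AlgebraicGeometry.Resolution Literature.AlgebraicGeometry.Resolution.HironakaScheme
open Literature.RingTheory.HilbertSamuel Literature.RingTheory.MvPolynomial
open Literature.AlgebraicGeometry.CossartJannsenSaito2020
open Summit.ResolutionOfSingularities.ResolutionOfSingularities.Theorems.SigmaMaxModificationsCorridor3.Directrix214Sharp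

namespace Summit.ResolutionOfSingularities.ResolutionOfSingularities.Theorems

namespace CampaignW42

universe u

/-! ## CJS Rem. 2.9 (c) for `s` variables: `e(J · k[X, Y]) = e(J) + s` -/

section Cylinder

variable {K : Type u} [Field K] {m : ℕ}

/-- The retraction `k[X, Y_1..Y_s] → k[X]`, `Y ↦ 0`, maps linear forms to linear forms. [folklore] -/
theorem isHomogeneous_one_aeval_addCases (s : ℕ) {f : MvPolynomial (Fin (m + s)) K} (hf : f.IsHomogeneous 1) :
    (aeval (Fin.addCases (motive := fun _ => MvPolynomial (Fin m) K) X (fun _ => 0)) f).IsHomogeneous 1 := by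
  have h1 : ∀ i : Fin (m + s),
      ((Fin.addCases (motive := fun _ => MvPolynomial (Fin m) K) X (fun _ => 0)) i).IsHomogeneous 1 := by
    intro i
    refine Fin.addCases (fun j => ?_) (fun j => ?_) i
    · rw [Fin.addCases_left]
      exact isHomogeneous_X K j
    · rw [Fin.addCases_right]
      exact isHomogeneous_zero (Fin m) K 1
  obtain ⟨a, rfl⟩ : ∃ a : Fin (m + s) → K, f = ∑ i, C (a i) * X i := by
    refine ⟨fun i => coeff (Finsupp.single i 1) f, ?_⟩
    exact eq_sum_C_mul_X_of_isHomogeneous_one hf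
  rw [map_sum]
  refine IsHomogeneous.sum _ _ _ fun i _ => ?_
  rw [map_mul, aeval_C, aeval_X, MvPolynomial.algebraMap_eq]
  exact (h1 i).C_mul (a i)

/-- The extended ideal comes back: `(J · k[X,Y]) ↦ J` under `Y ↦ 0`. [folklore] -/
theorem map_aeval_addCases_map_rename (s : ℕ) (J : Ideal (MvPolynomial (Fin m) K)) :
    (J.map ((rename (Fin.castAdd s) : MvPolynomial (Fin m) K →ₐ[K] MvPolynomial (Fin (m + s)) K) :
      MvPolynomial (Fin m) K →+* MvPolynomial (Fin (m + s)) K)).map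
      ((aeval (Fin.addCases (motive := fun _ => MvPolynomial (Fin m) K) X (fun _ => 0)) :
        MvPolynomial (Fin (m + s)) K →ₐ[K] MvPolynomial (Fin m) K) :
        MvPolynomial (Fin (m + s)) K →+* MvPolynomial (Fin m) K) = J := by
  rw [Ideal.map_map]
  have h : ((aeval (Fin.addCases (motive := fun _ => MvPolynomial (Fin m) K) X (fun _ => 0)) :
        MvPolynomial (Fin (m + s)) K →ₐ[K] MvPolynomial (Fin m) K) :
      MvPolynomial (Fin (m + s)) K →+* MvPolynomial (Fin m) K).comp
      ((rename (Fin.castAdd s) : MvPolynomial (Fin m) K →ₐ[K] MvPolynomial (Fin (m + s)) K) :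
        MvPolynomial (Fin m) K →+* MvPolynomial (Fin (m + s)) K) = RingHom.id _ := by
    refine RingHom.ext fun p => ?_
    rw [RingHom.comp_apply, RingHom.id_apply]
    change aeval _ (rename (Fin.castAdd s) p) = p
    rw [aeval_rename]
    have hcomp : (Fin.addCases (motive := fun _ => MvPolynomial (Fin m) K) X (fun _ => 0)) ∘ Fin.castAdd s = X := by
      funext j
      exact Fin.addCases_left j
    rw [hcomp, aeval_X_left, AlgHom.id_apply]
  rw [h, Ideal.map_id]

/-- **`dim_k 𝒯(J · k[X, Y]) = dim_k 𝒯(J)`** for `s` extra variables `Y` (CJS Rem. 2.9 (c); `≤` by transport along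
`k[X] ↪ k[X,Y]`, `≥` by transport along the retraction `Y ↦ 0`, tree `finrank_directrixSpace_map_algHom_le`).
[cite: CossartJannsenSaito2020, Rem. 2.9 (c)] -/
theorem finrank_directrixSpace_map_rename_castAdd (s : ℕ) (J : Ideal (MvPolynomial (Fin m) K)) :
    Module.finrank K (directrixSpace (J.map ((rename (Fin.castAdd s) :
        MvPolynomial (Fin m) K →ₐ[K] MvPolynomial (Fin (m + s)) K) : MvPolynomial (Fin m) K →+* MvPolynomial (Fin (m + s)) K))) =
      Module.finrank K (directrixSpace J) := by
  refine le_antisymm (finrank_directrixSpace_map_algHom_le J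
    (rename (Fin.castAdd s) : MvPolynomial (Fin m) K →ₐ[K] MvPolynomial (Fin (m + s)) K)
    fun f hf => hf.rename_isHomogeneous) ?_
  have h := finrank_directrixSpace_map_algHom_le
    (J.map ((rename (Fin.castAdd s) : MvPolynomial (Fin m) K →ₐ[K] MvPolynomial (Fin (m + s)) K) :
      MvPolynomial (Fin m) K →+* MvPolynomial (Fin (m + s)) K))
    (aeval (Fin.addCases (motive := fun _ => MvPolynomial (Fin m) K) X (fun _ => 0)) :
      MvPolynomial (Fin (m + s)) K →ₐ[K] MvPolynomial (Fin m) K)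
    fun f hf => isHomogeneous_one_aeval_addCases s hf
  rwa [map_aeval_addCases_map_rename] at h

/-- **CJS Rem. 2.9 (c), `s` variables: `e(J · k[X, Y_1, …, Y_s]) = e(J) + s`.** [cite: CossartJannsenSaito2020, Rem. 2.9 (c)] -/
theorem directrixDim_map_rename_castAdd (s : ℕ) (J : Ideal (MvPolynomial (Fin m) K)) :
    directrixDim (J.map ((rename (Fin.castAdd s) : MvPolynomial (Fin m) K →ₐ[K] MvPolynomial (Fin (m + s)) K) :
      MvPolynomial (Fin m) K →+* MvPolynomial (Fin (m + s)) K)) = directrixDim J + s := by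
  unfold directrixDim
  rw [finrank_directrixSpace_map_rename_castAdd]
  have := finrank_directrixSpace_le J
  omega

end Cylinder

/-! ## The campaign's fibre-cone ideal is res-type-001's `normalConeIdeal` -/

section FibreCone

variable {O : Type u} [CommRing O] [IsLocalRing O] {n : ℕ} (c : Fin n → O)

/-- **`fibreConeIdeal c = normalConeIdeal c`**: both are the ideal of `C_{X,D,x}` in `k[X_1, …, X_n]` for the generators `c`
of `I_{D,x}` — a form `F̄` of degree `d` lies in it iff `F(c) ∈ 𝔪·I^d` (`map_residue_mem_fibreConeIdeal_iff` /
`mem_normalConeForms_iff`). [cite: Hironaka1970NumericalCharacters, §2 p. 152–153] -/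
theorem fibreConeIdeal_eq_normalConeIdeal : fibreConeIdeal c = normalConeIdeal c := by
  apply le_antisymm
  · intro f hf
    rw [← sum_homogeneousComponent f]
    refine Ideal.sum_mem _ fun d _ => ?_
    have hd : homogeneousComponent d f ∈ fibreConeIdeal c := isHomogeneousIdeal_fibreConeIdeal c f hf d
    obtain ⟨G, hG, hGf⟩ := exists_isHomogeneous_map_residue_eq (homogeneousComponent_isHomogeneous d f)
    rw [← hGf] at hd ⊢
    exact mem_normalConeIdeal_of_mem_normalConeForms c
      ((mem_normalConeForms_iff c d _).mpr ⟨G, hG, (map_residue_mem_fibreConeIdeal_iff c hG).mp hd, rfl⟩)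
  · rw [normalConeIdeal, Ideal.span_le]
    intro f hf
    obtain ⟨d, hfd⟩ := Set.mem_iUnion.mp hf
    obtain ⟨G, hG, hGc, rfl⟩ := (mem_normalConeForms_iff c d f).mp hfd
    exact (map_residue_mem_fibreConeIdeal_iff c hG).mpr hGc

end FibreCone

/-! ## The direction of a near point lies in the ridge of the fibre cone — scheme level, chart data `(t, u)` -/

section Schemes

variable {X X' : Scheme.{u}} [IsLocallyNoetherian X] {π : X' ⟶ X} {D : X.IdealSheafData}

set_option maxHeartbeats 400000 in
/-- **The direction `ū ∈ κ(x')^m` of a near point of a permissible blow-up lies in Giraud's ridge of the fibre `C_{X,D,x}` of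
the normal cone**, `F(J_D)(κ(x'))`, for every system of generators `g` of `I_{D,x}` and every chart datum `(t, u)` at `x'`
(`t` a non-zero-divisor with `I_{D,x}𝒪_{X',x'} = (t)`, `π♯(g_i) = u_i t`, as in Hironaka (13.1) / F-51′), with the
`κ(x)`-algebra structure `κ(x) → κ(x')` of `π`. Hypotheses: `D` permissible at `x = π x'`, `𝒪_{X,x}` universally catenary,
`x'` near at level `N`. (gen-3 `aeval_chartGen_mem_ridge_of_isNearRing` through a Rees chart at `x'`, rescaled by the unit
`t / π♯(g_{j₀})`.) [cite: CossartJannsenSaito2020, Thm. 3.14, Rem. 18.29 (1)] [cite: Giraud1975, Cor. 2.4] -/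
theorem residue_mem_ridge_normalConeIdeal_of_isNearPoint (hπ : IsBlowup π D) (x' : X')
    (hperm : IdealSheafData.IsPermissibleAt D (π.base x'))
    (hUC : IsUniversallyCatenaryRing (X.presheaf.stalk (π.base x'))) {N : ℕ} (hnear : IsNearPoint π N x')
    {m : ℕ} (g : Fin m → X.presheaf.stalk (π.base x')) (hg : Ideal.span (Set.range g) = stalkIdeal D (π.base x'))
    (t : X'.presheaf.stalk x') (ht : t ∈ nonZeroDivisors (X'.presheaf.stalk x'))
    (hmap : (stalkIdeal D (π.base x')).map (π.stalkMap x').hom = Ideal.span {t})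
    (u : Fin m → X'.presheaf.stalk x') (hu : ∀ i, (π.stalkMap x').hom (g i) = u i * t) :
    letI : Algebra (ResidueField (X.presheaf.stalk (π.base x'))) (ResidueField (X'.presheaf.stalk x')) :=
      (ResidueField.map (π.stalkMap x').hom).toAlgebra
    (fun i => residue (X'.presheaf.stalk x') (u i)) ∈
      ridge (ResidueField (X'.presheaf.stalk x')) (normalConeIdeal g) := by
  classical
  letI algκ : Algebra (ResidueField (X.presheaf.stalk (π.base x'))) (ResidueField (X'.presheaf.stalk x')) :=
    (ResidueField.map (π.stalkMap x').hom).toAlgebra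
  -- a chart through `x'`
  obtain ⟨j₀, 𝔴, χ, hχ, hloc, h𝔴⟩ := hπ.exists_reesChart_stalk x' g hg
  letI algCO : Algebra (chartRing g j₀) (X'.presheaf.stalk x') := χ.toAlgebra
  letI algRO : Algebra (X.presheaf.stalk (π.base x')) (X'.presheaf.stalk x') := (π.stalkMap x').hom.toAlgebra
  haveI : IsLocalization.AtPrime (X'.presheaf.stalk x') 𝔴.asIdeal := hloc
  -- permissibility at `x`
  have hp : (Ideal.span (Set.range g)).IsPermissible := by rw [hg]; exact hperm
  haveI : IsRegularLocalRing (X.presheaf.stalk (π.base x') ⧸ Ideal.span (Set.range g)) := hp.1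
  haveI : IsDomain (X.presheaf.stalk (π.base x') ⧸ Ideal.span (Set.range g)) := isDomain_of_isRegularLocalRing _
  haveI : (Ideal.span (Set.range g)).IsPrime := (Ideal.Quotient.isDomain_iff_prime _).mp inferInstance
  have hOO' : ∀ r : X.presheaf.stalk (π.base x'),
      algebraMap (X.presheaf.stalk (π.base x')) (X'.presheaf.stalk x') r =
        (algebraMap (chartRing g j₀) (X'.presheaf.stalk x') : chartRing g j₀ →+* X'.presheaf.stalk x') (chartBase g j₀ r) :=
    fun r => (hχ r).symm
  have hnear' : IsNearRing (X.presheaf.stalk (π.base x')) (X'.presheaf.stalk x') N := hnear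
  -- the test map `θ = residue ∘ χ : chart → κ(x')`
  let θ : chartRing g j₀ →+* ResidueField (X'.presheaf.stalk x') := (residue (X'.presheaf.stalk x')).comp χ
  have hθP : ∀ z ∈ 𝔴.asIdeal, θ z = 0 := fun z hz => by
    change residue (X'.presheaf.stalk x') (χ z) = 0
    rw [residue_eq_zero_iff]
    exact (IsLocalization.AtPrime.to_map_mem_maximal_iff (X'.presheaf.stalk x') 𝔴.asIdeal z).mpr hz
  have hθ : ∀ r : X.presheaf.stalk (π.base x'), θ (chartBase g j₀ r) =
      algebraMap (ResidueField (X.presheaf.stalk (π.base x'))) (ResidueField (X'.presheaf.stalk x'))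
        (residue (X.presheaf.stalk (π.base x')) r) := fun r => by
    change residue (X'.presheaf.stalk x') (χ (chartBase g j₀ r)) =
      ResidueField.map (π.stalkMap x').hom (residue (X.presheaf.stalk (π.base x')) r)
    rw [hχ, ResidueField.map_residue]
  have key : (fun l => θ (chartGen g j₀ l)) ∈ ridge (ResidueField (X'.presheaf.stalk x')) (fibreConeIdeal g) :=
    aeval_chartGen_mem_ridge_of_isNearRing g j₀ 𝔴.asIdeal (X'.presheaf.stalk x') hUC hp.2.1 h𝔴 hOO' hnear' θ hθP hθ
  rw [fibreConeIdeal_eq_normalConeIdeal] at key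
  -- rescale: `t = w · π♯(g_{j₀})`, `π♯(g_{j₀}) = w' · t`, so `u_i = χ(e_i) · w'` with `w'` a unit
  have hcl : ∀ l, (π.stalkMap x').hom (g l) = χ (chartGen g j₀ l) * (π.stalkMap x').hom (g j₀) := fun l => by
    rw [← hχ, ← hχ, reesChartBase_apply_eq_mul_chartGen g j₀ l, map_mul, mul_comm]
  have hgj₀ : (π.stalkMap x').hom (g j₀) ∈ Ideal.span {t} := by
    rw [← hmap]
    exact Ideal.mem_map_of_mem _ (by rw [← hg]; exact Ideal.subset_span ⟨j₀, rfl⟩)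
  obtain ⟨w', hw'⟩ := Ideal.mem_span_singleton'.mp hgj₀
  -- `hw' : w' * t = π♯(g j₀)`
  have ht_mem : t ∈ Ideal.span {(π.stalkMap x').hom (g j₀)} := by
    have h1 : Ideal.span {t} ≤ Ideal.span {(π.stalkMap x').hom (g j₀)} := by
      rw [← hmap, ← hg, Ideal.map_span, Ideal.span_le]
      rintro _ ⟨_, ⟨l, rfl⟩, rfl⟩
      rw [SetLike.mem_coe, hcl l]
      exact Ideal.mul_mem_left _ _ (Ideal.mem_span_singleton_self _)
    exact h1 (Ideal.mem_span_singleton_self t)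
  obtain ⟨w, hw⟩ := Ideal.mem_span_singleton'.mp ht_mem
  -- `hw : w * π♯(g j₀) = t`
  have hunit : w * w' = 1 := by
    have h1 : (w * w') * t = 1 * t := by rw [mul_assoc, hw', hw, one_mul]
    exact (mul_cancel_right_mem_nonZeroDivisors ht).mp h1
  have hw'unit : IsUnit w' := IsUnit.of_mul_eq_one _ (by rw [mul_comm]; exact hunit)
  have hui : ∀ i, u i = w' * χ (chartGen g j₀ i) := fun i => by
    have h1 : u i * t = (w' * χ (chartGen g j₀ i)) * t := by
      rw [← hu i, hcl i, ← hw']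
      ring
    exact (mul_cancel_right_mem_nonZeroDivisors ht).mp h1
  have hres : (fun i => residue (X'.presheaf.stalk x') (u i)) =
      residue (X'.presheaf.stalk x') w' • fun l => θ (chartGen g j₀ l) := by
    funext i
    rw [Pi.smul_apply, smul_eq_mul, hui i, map_mul]
    rfl
  rw [hres]
  exact smul_mem_ridge (isHomogeneousIdeal_normalConeIdeal g) (hw'unit.map (residue (X'.presheaf.stalk x'))) key

end Schemes

end CampaignW42

end Summit.ResolutionOfSingularities.ResolutionOfSingularities.Theorems

end
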